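import Summits.ResolutionOfSingularities.ResolutionOfSingularities.Theses.SeparableGalois
import Literature.AlgebraicGeometry.Resolution.AlterationsResolution
import Literature.AlgebraicGeometry.Resolution.AbsoluteIntegralClosureNoResolution
import Literature.AlgebraicGeometry.Resolution.RegularLocalRingsFlatDescent

/-!
# `GaloisQuotientModels` — negative lemmas I: logical position and load-bearing hypotheses

Support (negative) lemmas for crux `stmt-ResolutionOfSingularities-18955`
(`Summit.ResolutionOfSingularities.ResolutionOfSingularities.Theses.SeparableGalois.GaloisQuotientModels`,
route SeparableGalois, rank 2: for every prime `p`, every PERFECT field `k` of characteristic `p` and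
every integral separated finite-type `X / k` there are a proper birational `π : X₁ → X`, a regular
integral `X'` with an action `ρ : G →* Aut X'` of a finite group, and a finite surjective generically
étale `ρ`-invariant `q : X' → X₁` whose fibres are `G`-orbits — "a birational Galois-quotient model"),
filed by the standing disprover (cdisprove cycle 1; work file `Cruxes/GaloisQuotientModels/Disproof.lean`).
This file declares NO definition (variants of the crux are written out inline; the recurring ∃-block
is the conclusion of the crux for the scheme in question) and NO declaration concludes a route decl
positively.

* `not_resolutionOfSingularities_of_not_galoisQuotientModels` — the crux is a CONSEQUENCE of the
  summit (present a resolution `X₁ → X` as its own quotient by the trivial group, `q = 𝟙`): a disproof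
  of the crux is a counterexample to resolution of singularities in characteristic `p`; none is known.
  `not_resolutionOfSingularities_of_not_allFields` — the same for the variant over ALL fields of
  characteristic `p`: the hypothesis `PerfectField k` is NOT load-bearing for truth-modulo-the-summit
  (it is there for the route's mechanism, de Jong's generic smoothness), and cannot be shown necessary
  without refuting the summit.
* `hasResolution_of_etale_presentation` — the natural strengthening "`q` étale" (everywhere, not only
  over a dense open) already RESOLVES `X`: regularity descends along the flat local stalk maps of an
  étale surjection (Matsumura 23.7 (i), in tree), so `X₁` is regular and `π` is a resolution. All the
  content of the crux beyond the summit sits in the ramification of `q`.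
* `galoisQuotientModels_false_without_isIntegral` — LOAD-BEARING: with the summit's hypothesis
  `IsReduced X` in place of `IsIntegral X` the crux is FALSE at every prime (witness `Spec (𝔽_p × 𝔽_p)`:
  an integral `X₁` dominating `X` forces `X` irreducible). The assembly's reduction to integral closed
  subschemes (`ComponentGluing.hasResolution_of_forall_closeds`) is therefore necessary, not cosmetic.
* `not_galoisQuotientConclusion_spec_of_forall_exists_pow_eq`,
  `galoisQuotientModels_false_without_locallyOfFiniteType` — LOAD-BEARING: with `LocallyOfFiniteType f`
  dropped the crux is FALSE at every prime. Witness `X = Spec 𝔽_p[T]⁺` (absolute integral closure of the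
  affine line: affine, integral, every element a square, not a field — `Literature…AbsoluteIntegralClosureNoResolution`).
  The obstruction is new relative to that file (whose argument needs a REGULAR point of `X` itself): if
  every element of a domain `R` is an `n`-th power (`n ≥ 2`) and `R` has a non-zero prime `Q`, then NO
  proper dominant `X₁ → Spec R` followed by a finite surjection `X' → X₁` from an integral scheme with a
  Noetherian local ring at a point above `Q` exists: the comparison map `R → 𝒪_{X',x'}` sends `Q` into
  `𝔪_{x'}`, hence a non-zero `y ∈ Q` into `⋂ₙ 𝔪_{x'}ⁿ = 0` (Krull), while it is injective on
  non-zero elements (`X'` integral, `X' → Spec R` dominant). Reading for the provers: every proof of the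
  crux must use the finite type of `X` through the Noetherianity of the local rings ABOVE the non-generic
  points of `X` (not merely at a dense open of `X`, which a modification could dodge).

## Sources
* A. J. de Jong, *Families of curves and alterations*, Ann. Inst. Fourier 47 (1997), Thm. 5.13 /
  Cor. 5.15 (the purely inseparable Galois alteration the crux sharpens).
* H. Matsumura, *Commutative Ring Theory*, CUP 1986, Thm. 8.10 (Krull intersection), Thm. 23.7 (i)
  (flat descent of regularity) — both in tree.
* M. Artin, *On the joins of Hensel rings*, Adv. Math. 7 (1971) 282–296 (absolute integral closure),
  as vendored in `Literature/AlgebraicGeometry/Resolution/AbsoluteIntegralClosureNoResolution.lean`.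
* The Stacks Project, Tags 01RN (birational), 02IS (regular schemes), 0CC1 (dominant). Folklore.
-/

noncomputable section

-- single-problem summit: the doubled namespace component `ResolutionOfSingularities` is forced
set_option linter.dupNamespace false

open CategoryTheory AlgebraicGeometry TopologicalSpace Topology
open Literature.AlgebraicGeometry.Resolution

namespace Summit.ResolutionOfSingularities.ResolutionOfSingularities.Theorems.GaloisQuotientModels.Negative

open Summit.ResolutionOfSingularities.ResolutionOfSingularities.Theses.SeparableGalois (GaloisQuotientModels)

/-! ## The crux is a consequence of the summit; the étale strengthening is the summit -/

/-- The conclusion of the crux for an integral `X` from a resolution `π : X₁ → X`: the trivial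
presentation `X' = X₁`, `q = 𝟙`, `G = 1` (the source of a birational morphism onto an integral scheme
is integral as soon as it is reduced, and regular schemes are reduced). [folklore] -/
theorem conclusion_of_isResolution {X X₁ : Scheme.{0}} [IsIntegral X] {π : X₁ ⟶ X}
    (h : IsResolution π) :
    ∃ (X₁ X' : Scheme.{0}) (π : X₁ ⟶ X) (q : X' ⟶ X₁) (G : Type) (_ : Group G) (_ : Finite G)
      (ρ : G →* Aut X'), IsProper π ∧ IsBirational π ∧ IsIntegral X₁ ∧ IsIntegral X' ∧
      Scheme.IsRegular X' ∧ IsFinite q ∧ Function.Surjective q.base ∧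
      (∃ U : X₁.Opens, Dense (U : Set X₁) ∧ Etale (q ∣_ U)) ∧ (∀ g : G, (ρ g).hom ≫ q = q) ∧
      (∀ x y : X', q.base x = q.base y → ∃ g : G, (ρ g).hom.base x = y) := by
  haveI : IsReduced X₁ := h.isRegular.isReduced
  haveI : IsIntegral X₁ := h.isBirational.isIntegral
  haveI : IsProper π := h.isProper
  refine ⟨X₁, X₁, π, 𝟙 X₁, PUnit.{1}, inferInstance, inferInstance, 1, inferInstance, h.isBirational,
    inferInstance, inferInstance, h.isRegular, inferInstance, ?_, ⟨⊤, by simp, inferInstance⟩,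
    fun g => Category.id_comp _, fun x y hxy => ⟨1, hxy⟩⟩
  intro x; exact ⟨x, by simp⟩

/-- **The crux over ALL fields of characteristic `p` is still a consequence of the summit**, so a
disproof of that variant — in particular a proof that `PerfectField k` is necessary — is a counterexample
to resolution of singularities in characteristic `p`. [folklore] -/
theorem not_resolutionOfSingularities_of_not_allFields
    (h : ¬ ∀ p : ℕ, p.Prime → ∀ (k : Type) [Field k] [CharP k p] (X : Scheme.{0})
      (f : X ⟶ Spec (.of k)), IsSeparated f → LocallyOfFiniteType f → QuasiCompact f → IsIntegral X →
      ∃ (X₁ X' : Scheme.{0}) (π : X₁ ⟶ X) (q : X' ⟶ X₁) (G : Type) (_ : Group G) (_ : Finite G)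
        (ρ : G →* Aut X'), IsProper π ∧ IsBirational π ∧ IsIntegral X₁ ∧ IsIntegral X' ∧
        Scheme.IsRegular X' ∧ IsFinite q ∧ Function.Surjective q.base ∧
        (∃ U : X₁.Opens, Dense (U : Set X₁) ∧ Etale (q ∣_ U)) ∧ (∀ g : G, (ρ g).hom ≫ q = q) ∧
        (∀ x y : X', q.base x = q.base y → ∃ g : G, (ρ g).hom.base x = y)) :
    ¬ _root_.ResolutionOfSingularities := fun hR =>
  h fun p hp k _ _ X f hs hl hq _ => by
    obtain ⟨X₁, π, hπ⟩ := (_root_.ResolutionOfSingularities_iff.mp hR p hp) k X f hs hl hq inferInstance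
    exact conclusion_of_isResolution hπ

/-- **A disproof of the crux is a disproof of resolution of singularities in positive characteristic**
(the crux is the all-fields variant restricted to perfect ground fields). This is why every cheap
attack fails: no integral variety over a perfect field without a resolution is known in any dimension.
[folklore] -/
theorem not_resolutionOfSingularities_of_not_galoisQuotientModels (h : ¬ GaloisQuotientModels) :
    ¬ _root_.ResolutionOfSingularities :=
  not_resolutionOfSingularities_of_not_allFields fun hall => h fun p hp k _ _ _ X f hs hl hq hi =>
    hall p hp k X f hs hl hq hi

/-- **Regularity descends along an étale surjection** onto a locally Noetherian scheme: the stalk maps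
are flat local homomorphisms of Noetherian local rings (Matsumura 23.7 (i),
`IsRegularLocalRing.of_flat_ringHom`). [cite: Matsumura1987, Thm. 23.7 (i)] -/
theorem isRegular_of_etale_surjective {X' X₁ : Scheme.{0}} (q : X' ⟶ X₁) [Etale q]
    (hsurj : Function.Surjective q.base) [IsLocallyNoetherian X₁] (hreg : Scheme.IsRegular X') :
    Scheme.IsRegular X₁ := by
  intro x₁
  obtain ⟨x', rfl⟩ := hsurj x₁
  haveI := hreg x'
  exact IsRegularLocalRing.of_flat_ringHom (q.stalkMap x').hom (Flat.stalkMap q x')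

/-- **The étale strengthening of the crux is resolution itself**: if in the data of the crux the finite
cover `q : X' → X₁` is étale EVERYWHERE (and `X₁` is locally Noetherian, as it is in the crux, being
proper over a finite-type `X / k`), then `X₁` is regular and `π : X₁ → X` is a resolution of `X` —
the group, the invariance and the orbit condition are not even needed. [folklore] -/
theorem hasResolution_of_etale_presentation {X X₁ X' : Scheme.{0}} (π : X₁ ⟶ X) (q : X' ⟶ X₁)
    [IsProper π] (hbir : IsBirational π) [Etale q] (hsurj : Function.Surjective q.base)
    [IsLocallyNoetherian X₁] (hreg : Scheme.IsRegular X') : Scheme.HasResolution X :=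
  ⟨X₁, π, inferInstance, hbir, isRegular_of_etale_surjective q hsurj hreg⟩

/-- In the crux `X₁` IS locally Noetherian: proper over `X`, itself of finite type over a field.
[folklore] -/
theorem isLocallyNoetherian_of_isProper_comp {X X₁ : Scheme.{0}} {k : Type} [Field k]
    (f : X ⟶ Spec (.of k)) (π : X₁ ⟶ X) [IsProper π] [LocallyOfFiniteType f] :
    IsLocallyNoetherian X₁ :=
  LocallyOfFiniteType.isLocallyNoetherian (π ≫ f)

/-! ## `IsIntegral X` is load-bearing: `IsReduced X` (the summit's hypothesis) does not suffice -/

/-- The conclusion of the crux forces `X` to be irreducible: `X₁` is integral and `π` is dominant.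
[folklore] -/
theorem irreducibleSpace_of_conclusion {X : Scheme.{0}}
    (h : ∃ (X₁ X' : Scheme.{0}) (π : X₁ ⟶ X) (q : X' ⟶ X₁) (G : Type) (_ : Group G) (_ : Finite G)
      (ρ : G →* Aut X'), IsProper π ∧ IsBirational π ∧ IsIntegral X₁ ∧ IsIntegral X' ∧
      Scheme.IsRegular X' ∧ IsFinite q ∧ Function.Surjective q.base ∧
      (∃ U : X₁.Opens, Dense (U : Set X₁) ∧ Etale (q ∣_ U)) ∧ (∀ g : G, (ρ g).hom ≫ q = q) ∧
      (∀ x y : X', q.base x = q.base y → ∃ g : G, (ρ g).hom.base x = y)) :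
    IrreducibleSpace X := by
  obtain ⟨X₁, X', π, q, G, _, _, ρ, hπ, hbir, h1, -⟩ := h
  haveI := hbir.isDominant
  have hpre : IsPreirreducible (Set.range π.base) := by
    rw [← Set.image_univ]
    exact (IrreducibleSpace.isIrreducible_univ X₁).2.image _ π.base.hom.continuous.continuousOn
  have huniv : IsPreirreducible (Set.univ : Set X) := by
    rw [← π.denseRange.closure_range]; exact hpre.closure
  obtain ⟨x₁⟩ := (inferInstance : Nonempty X₁)
  haveI : PreirreducibleSpace X := ⟨huniv⟩
  exact ⟨⟨π.base x₁⟩⟩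

/-- `Spec (K × K)` (two points) is not irreducible: `D((1,0))` and `D((0,1))` are disjoint non-empty
opens. [folklore] -/
theorem not_irreducibleSpace_spec_prod (K : Type) [Field K] :
    ¬ IrreducibleSpace (Spec (.of (K × K))) := by
  intro h
  haveI : PreirreducibleSpace (PrimeSpectrum (K × K)) := h.toPreirreducibleSpace
  let P₁ : PrimeSpectrum (K × K) := ⟨RingHom.ker (RingHom.fst K K), RingHom.ker_isPrime _⟩
  let P₂ : PrimeSpectrum (K × K) := ⟨RingHom.ker (RingHom.snd K K), RingHom.ker_isPrime _⟩
  have h1 : P₁ ∈ PrimeSpectrum.basicOpen ((1, 0) : K × K) := by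
    rw [PrimeSpectrum.mem_basicOpen]; simp [P₁, RingHom.mem_ker]
  have h2 : P₂ ∈ PrimeSpectrum.basicOpen ((0, 1) : K × K) := by
    rw [PrimeSpectrum.mem_basicOpen]; simp [P₂, RingHom.mem_ker]
  have hd : Dense ((PrimeSpectrum.basicOpen ((1, 0) : K × K) : Opens (PrimeSpectrum (K × K))) :
      Set (PrimeSpectrum (K × K))) :=
    (PrimeSpectrum.basicOpen ((1, 0) : K × K)).isOpen.dense ⟨P₁, h1⟩
  obtain ⟨z, hz2, hz1⟩ := hd.inter_open_nonempty _ (PrimeSpectrum.basicOpen ((0, 1) : K × K)).isOpen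
    ⟨P₂, h2⟩
  have hz : z ∈ PrimeSpectrum.basicOpen ((1, 0) * (0, 1) : K × K) := by
    rw [PrimeSpectrum.basicOpen_mul]; exact ⟨hz1, hz2⟩
  have h0 : ((1, 0) * (0, 1) : K × K) = 0 := by simp
  rw [h0, PrimeSpectrum.basicOpen_zero] at hz
  exact TopologicalSpace.Opens.mem_bot.mp hz

/-- A product of reduced rings is reduced. [folklore] -/
theorem isReduced_prod (R S : Type*) [CommRing R] [CommRing S] [IsReduced R] [IsReduced S] :
    IsReduced (R × S) := by
  refine ⟨fun x hx => ?_⟩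
  obtain ⟨n, hn⟩ := hx
  have h1 : x.1 ^ n = 0 := by simpa using congrArg Prod.fst hn
  have h2 : x.2 ^ n = 0 := by simpa using congrArg Prod.snd hn
  exact Prod.ext (IsReduced.eq_zero _ ⟨n, h1⟩) (IsReduced.eq_zero _ ⟨n, h2⟩)

/-- **`IsIntegral X` is load-bearing, at every prime `p`**: the crux with the summit's hypothesis
`IsReduced X` in place of `IsIntegral X` FAILS at `X = Spec (𝔽_p × 𝔽_p) → Spec 𝔽_p` (finite, hence
separated, of finite type and quasi-compact; reduced; `𝔽_p` is perfect), a reducible scheme, whereas the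
conclusion forces irreducibility. [folklore] -/
theorem galoisQuotientModels_false_without_isIntegral_at (p : ℕ) [Fact p.Prime] :
    ¬ ∀ (k : Type) [Field k] [CharP k p] [PerfectField k] (X : Scheme.{0}) (f : X ⟶ Spec (.of k)),
      IsSeparated f → LocallyOfFiniteType f → QuasiCompact f → IsReduced X →
      ∃ (X₁ X' : Scheme.{0}) (π : X₁ ⟶ X) (q : X' ⟶ X₁) (G : Type) (_ : Group G) (_ : Finite G)
        (ρ : G →* Aut X'), IsProper π ∧ IsBirational π ∧ IsIntegral X₁ ∧ IsIntegral X' ∧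
        Scheme.IsRegular X' ∧ IsFinite q ∧ Function.Surjective q.base ∧
        (∃ U : X₁.Opens, Dense (U : Set X₁) ∧ Etale (q ∣_ U)) ∧ (∀ g : G, (ρ g).hom ≫ q = q) ∧
        (∀ x y : X', q.base x = q.base y → ∃ g : G, (ρ g).hom.base x = y) := by
  intro h
  let f : Spec (.of (ZMod p × ZMod p)) ⟶ Spec (.of (ZMod p)) :=
    Spec.map (CommRingCat.ofHom (algebraMap (ZMod p) (ZMod p × ZMod p)))
  haveI : LocallyOfFiniteType f := by
    rw [HasRingHomProperty.Spec_iff (P := @LocallyOfFiniteType), CommRingCat.hom_ofHom,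
      RingHom.finiteType_algebraMap]
    infer_instance
  haveI := isReduced_prod (ZMod p) (ZMod p)
  exact not_irreducibleSpace_spec_prod (ZMod p) (irreducibleSpace_of_conclusion
    (h (ZMod p) (Spec (.of (ZMod p × ZMod p))) f inferInstance inferInstance inferInstance inferInstance))

/-- **`IsIntegral X` is load-bearing** (all-primes form: the crux with `IsReduced X` for `IsIntegral X`
is false). [folklore] -/
theorem galoisQuotientModels_false_without_isIntegral :
    ¬ ∀ p : ℕ, p.Prime → ∀ (k : Type) [Field k] [CharP k p] [PerfectField k] (X : Scheme.{0})
      (f : X ⟶ Spec (.of k)), IsSeparated f → LocallyOfFiniteType f → QuasiCompact f → IsReduced X →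
      ∃ (X₁ X' : Scheme.{0}) (π : X₁ ⟶ X) (q : X' ⟶ X₁) (G : Type) (_ : Group G) (_ : Finite G)
        (ρ : G →* Aut X'), IsProper π ∧ IsBirational π ∧ IsIntegral X₁ ∧ IsIntegral X' ∧
        Scheme.IsRegular X' ∧ IsFinite q ∧ Function.Surjective q.base ∧
        (∃ U : X₁.Opens, Dense (U : Set X₁) ∧ Etale (q ∣_ U)) ∧ (∀ g : G, (ρ g).hom ≫ q = q) ∧
        (∀ x y : X', q.base x = q.base y → ∃ g : G, (ρ g).hom.base x = y) := fun h =>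
  haveI : Fact (Nat.Prime 2) := ⟨Nat.prime_two⟩
  galoisQuotientModels_false_without_isIntegral_at 2 (h 2 Nat.prime_two)

/-! ## `LocallyOfFiniteType f` is load-bearing: root-closed affine schemes have no Galois-quotient model -/

/-- **Key obstruction.** Let `R` be a domain in which every element is an `n`-th power for some fixed
`n ≥ 2` (a perfect domain of characteristic `p`, an absolutely integrally closed domain, …) and which has
a non-zero prime `Q`. Then `Spec R` has NO "Galois-quotient model" in the sense of the crux — in fact no
proper dominant `X₁ → Spec R` followed by a finite surjection `X' → X₁` from an INTEGRAL scheme whose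
local ring at some point above `Q` is Noetherian. Proof: `π` is surjective (closed and dominant); pick
`x' ↦ x₁ ↦ Q`; the comparison map `φ : R → 𝒪_{X',x'}` (global sections, then germ) sends `Q` into the
maximal ideal (the basic open of `a ∈ Q` pulls back to an open missing `x'`), so by `a = bⁿ`, `b ∈ Q`
recursively, a non-zero `y ∈ Q` lands in `⋂ᵢ 𝔪ⁱ = 0` (Krull intersection, `𝒪_{X',x'}` regular hence
Noetherian local); but `φ y ≠ 0`: germs of the integral `X'` are injective and `X' → Spec R` is dominant,
so the pull-back of the non-empty `D(y)` is non-empty. [folklore] -/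
theorem not_galoisQuotientConclusion_spec_of_forall_exists_pow_eq (R : Type) [CommRing R] [IsDomain R]
    {n : ℕ} (hn : 2 ≤ n) (hpow : ∀ a : R, ∃ b : R, b ^ n = a)
    (hQ : ∃ Q : Ideal R, Q.IsPrime ∧ Q ≠ ⊥) :
    ¬ ∃ (X₁ X' : Scheme.{0}) (π : X₁ ⟶ Spec (.of R)) (q : X' ⟶ X₁) (G : Type) (_ : Group G)
      (_ : Finite G) (ρ : G →* Aut X'), IsProper π ∧ IsBirational π ∧ IsIntegral X₁ ∧ IsIntegral X' ∧
      Scheme.IsRegular X' ∧ IsFinite q ∧ Function.Surjective q.base ∧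
      (∃ U : X₁.Opens, Dense (U : Set X₁) ∧ Etale (q ∣_ U)) ∧ (∀ g : G, (ρ g).hom ≫ q = q) ∧
      (∀ x y : X', q.base x = q.base y → ∃ g : G, (ρ g).hom.base x = y) := by
  rintro ⟨X₁, X', π, q, G, _, _, ρ, hπ, hbir, h1, h2, hreg, -, hsurj, -, -, -⟩
  obtain ⟨Q, hQp, hQne⟩ := hQ
  obtain ⟨y, hyQ, hy0⟩ := Submodule.exists_mem_ne_zero_of_ne_bot hQne
  let x₀ : Spec (.of R) := ⟨Q, hQp⟩
  haveI := hbir.isDominant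
  haveI : Surjective q := ⟨hsurj⟩
  have hπsurj : Function.Surjective π.base :=
    (surjective_of_isDominant_of_isClosed_range π π.isClosedMap.isClosed_range).1
  obtain ⟨x₁, hx₁⟩ := hπsurj x₀
  obtain ⟨x', hx'⟩ := hsurj x₁
  let g : X' ⟶ Spec (.of R) := q ≫ π
  have hgx : g.base x' = x₀ := by simp [g, hx', hx₁]
  haveI : IsDominant g := inferInstanceAs (IsDominant (q ≫ π))
  haveI : IsRegularLocalRing (X'.presheaf.stalk x') := hreg x'
  -- the comparison homomorphism `R → 𝒪_{X', x'}`
  let s : R → Γ(X', ⊤) := fun a => g.appTop ((Scheme.ΓSpecIso (.of R)).inv a)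
  let φ : R →+* X'.presheaf.stalk x' :=
    (X'.presheaf.germ ⊤ x' trivial).hom.comp ((g.appTop).hom.comp (Scheme.ΓSpecIso (.of R)).inv.hom)
  have hφ : ∀ a, φ a = X'.presheaf.germ ⊤ x' trivial (s a) := fun a => rfl
  -- (1) elements of `Q` go to the maximal ideal
  have hmem : ∀ a ∈ Q, φ a ∈ IsLocalRing.maximalIdeal (X'.presheaf.stalk x') := by
    intro a ha
    rw [IsLocalRing.mem_maximalIdeal, mem_nonunits_iff, hφ]
    intro hu
    have hx : x' ∈ X'.basicOpen (s a) := (X'.mem_basicOpen_top (s a) x').mpr hu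
    have : x' ∈ g ⁻¹ᵁ (Spec (.of R)).basicOpen ((Scheme.ΓSpecIso (.of R)).inv a) := by
      rwa [Scheme.preimage_basicOpen_top]
    rw [basicOpen_eq_of_affine] at this
    have hx₀ : x₀ ∈ PrimeSpectrum.basicOpen a := hgx ▸ this
    exact (PrimeSpectrum.mem_basicOpen a x₀).mp hx₀ ha
  -- (2) hence `φ y ∈ ⋂ᵢ 𝔪ⁱ = 0`
  have hpow' : ∀ i : ℕ, ∀ a ∈ Q, φ a ∈ IsLocalRing.maximalIdeal (X'.presheaf.stalk x') ^ i := by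
    intro i
    induction i with
    | zero => intro a _; simp
    | succ i ih =>
      intro a ha
      obtain ⟨b, rfl⟩ := hpow a
      have hb : b ∈ Q := hQp.mem_of_pow_mem n ha
      obtain ⟨m, rfl⟩ : ∃ m, n = m + 2 := ⟨n - 2, by omega⟩
      rw [map_pow, pow_succ (φ b) (m + 1), pow_succ (IsLocalRing.maximalIdeal _) i]
      refine Ideal.mul_mem_mul ?_ (hmem b hb)
      rw [pow_succ']
      exact Ideal.mul_mem_right _ _ (ih b hb)
  have hy_mem : φ y ∈ ⨅ i : ℕ, IsLocalRing.maximalIdeal (X'.presheaf.stalk x') ^ i :=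
    Ideal.mem_iInf.mpr fun i => hpow' i y hyQ
  rw [Ideal.iInf_pow_eq_bot_of_isLocalRing _ (IsLocalRing.maximalIdeal.isMaximal _).ne_top,
    Ideal.mem_bot, hφ] at hy_mem
  -- (3) but `φ y ≠ 0`: `X'` is integral and `g` is dominant
  have hs0 : s y = 0 :=
    germ_injective_of_isIntegral X' (U := ⊤) x' trivial (by rw [hy_mem, map_zero])
  have hpre : g ⁻¹ᵁ (Spec (.of R)).basicOpen ((Scheme.ΓSpecIso (.of R)).inv y) = ⊥ := by
    rw [Scheme.preimage_basicOpen_top]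
    change X'.basicOpen (s y) = ⊥
    rw [hs0, Scheme.basicOpen_zero]
  rw [basicOpen_eq_of_affine] at hpre
  have hne : ((PrimeSpectrum.basicOpen y : Opens (PrimeSpectrum R)) : Set (PrimeSpectrum R)).Nonempty := by
    refine ⟨⟨⊥, Ideal.isPrime_bot⟩, ?_⟩
    change (⟨⊥, Ideal.isPrime_bot⟩ : PrimeSpectrum R) ∈ PrimeSpectrum.basicOpen y
    rw [PrimeSpectrum.mem_basicOpen]
    simpa using hy0
  obtain ⟨z, hz, ⟨w, rfl⟩⟩ :=
    g.denseRange.inter_open_nonempty _ (PrimeSpectrum.basicOpen y).isOpen hne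
  have : w ∈ g ⁻¹ᵁ (PrimeSpectrum.basicOpen y) := hz
  rw [hpre] at this
  exact TopologicalSpace.Opens.mem_bot.mp this

open Polynomial in
/-- **`LocallyOfFiniteType f` is load-bearing, at every prime `p`**: the crux with the finite-type
hypothesis dropped FAILS at `X = Spec 𝔽_p[T]⁺ → Spec 𝔽_p`, the absolute integral closure of the affine
line (affine, hence separated and quasi-compact; integral; `𝔽_p` perfect): every element of `𝔽_p[T]⁺` is
a square and `T` lies in a non-zero prime. [folklore] -/
theorem galoisQuotientModels_false_without_locallyOfFiniteType_at (p : ℕ) [Fact p.Prime] :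
    ¬ ∀ (k : Type) [Field k] [CharP k p] [PerfectField k] (X : Scheme.{0}) (f : X ⟶ Spec (.of k)),
      IsSeparated f → QuasiCompact f → IsIntegral X →
      ∃ (X₁ X' : Scheme.{0}) (π : X₁ ⟶ X) (q : X' ⟶ X₁) (G : Type) (_ : Group G) (_ : Finite G)
        (ρ : G →* Aut X'), IsProper π ∧ IsBirational π ∧ IsIntegral X₁ ∧ IsIntegral X' ∧
        Scheme.IsRegular X' ∧ IsFinite q ∧ Function.Surjective q.base ∧
        (∃ U : X₁.Opens, Dense (U : Set X₁) ∧ Etale (q ∣_ U)) ∧ (∀ g : G, (ρ g).hom ≫ q = q) ∧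
        (∀ x y : X', q.base x = q.base y → ∃ g : G, (ρ g).hom.base x = y) := by
  intro h
  have hX0 : algebraMap (ZMod p)[X]
      ↥(integralClosure (ZMod p)[X] (AlgebraicClosure (RatFunc (ZMod p)))) X ≠ 0 :=
    fun h0 => Polynomial.X_ne_zero
      (absoluteIntegralClosure_algebraMap_injective p (by rw [h0, map_zero]))
  obtain ⟨Q, hQ, hQne, -⟩ := absoluteIntegralClosure_exists_prime_not_mem p _ hX0
  exact not_galoisQuotientConclusion_spec_of_forall_exists_pow_eq
    ↥(integralClosure (ZMod p)[X] (AlgebraicClosure (RatFunc (ZMod p)))) le_rfl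
    (absoluteIntegralClosure_exists_sq_eq p) ⟨Q, hQ, hQne⟩ (h (ZMod p) _
      (Spec.map (CommRingCat.ofHom ((algebraMap (ZMod p)[X]
        ↥(integralClosure (ZMod p)[X] (AlgebraicClosure (RatFunc (ZMod p))))).comp Polynomial.C)))
      inferInstance inferInstance inferInstance)

/-- **`LocallyOfFiniteType f` is load-bearing** (all-primes form: the crux with the finite-type
hypothesis dropped is false). [folklore] -/
theorem galoisQuotientModels_false_without_locallyOfFiniteType :
    ¬ ∀ p : ℕ, p.Prime → ∀ (k : Type) [Field k] [CharP k p] [PerfectField k] (X : Scheme.{0})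
      (f : X ⟶ Spec (.of k)), IsSeparated f → QuasiCompact f → IsIntegral X →
      ∃ (X₁ X' : Scheme.{0}) (π : X₁ ⟶ X) (q : X' ⟶ X₁) (G : Type) (_ : Group G) (_ : Finite G)
        (ρ : G →* Aut X'), IsProper π ∧ IsBirational π ∧ IsIntegral X₁ ∧ IsIntegral X' ∧
        Scheme.IsRegular X' ∧ IsFinite q ∧ Function.Surjective q.base ∧
        (∃ U : X₁.Opens, Dense (U : Set X₁) ∧ Etale (q ∣_ U)) ∧ (∀ g : G, (ρ g).hom ≫ q = q) ∧
        (∀ x y : X', q.base x = q.base y → ∃ g : G, (ρ g).hom.base x = y) := fun h =>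
  haveI : Fact (Nat.Prime 2) := ⟨Nat.prime_two⟩
  galoisQuotientModels_false_without_locallyOfFiniteType_at 2 (h 2 Nat.prime_two)

end Summit.ResolutionOfSingularities.ResolutionOfSingularities.Theorems.GaloisQuotientModels.Negative

end
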